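import Summits.AtomisticToContinuum.Crystallization.Theorems.FrustratedLawDichotomyStrainedPatchHomBisect
import Summits.AtomisticToContinuum.Crystallization.Theorems.FrustratedLawDichotomyStrainedPatchHomLeafCheckW

/-!
# Reflected BISECTION-TREE driver for the `HomFloor` certificate: `CertTree`, `treeOK`, soundness by structural induction; fcc Gram instance

decomp-a2c hand-2 g21 (crux `AperiodicFrustratedLawGap`, stmt-AtomisticToContinuum-27623; critic row 769 «cover format: BISECTION TREE, cover by structural
induction», row 783 (4)(iii) bridge).  A certificate is a binary tree whose nodes name the coordinate to bisect; the boxes are IMPLICIT (root box + path), so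
the COVER property holds by construction and never has to be checked numerically:

* `CertTree κ` (`leaf` / `split k l r`), `treeOK verdict t c w : Bool` — runs a Boolean leaf verdict on every leaf box, boxes in scaled integers
  (centre `c`, half-width `w : κ → ℤ`, real box `|xᵢ − cᵢ/s| ≤ wᵢ/s`); a split requires `w k` even (exact integer halving) — structural recursion, kernel-
  and natively evaluable;
* ★ `treeOK_sound` : if the verdict is sound for a property `P` of real points, `treeOK … = true` gives `P` on the WHOLE root box
  (induction on the tree with hand-1's `…HomBisect.forall_box_of_forall_children`);
* fcc Gram instance: `leafOK2 μ c w := termsOK2 c w ∧ μ ≤ sumV2 c − sumG2 c w − sumC2 c w` (the v2 leaf checker of `…HomLeafCheckW` as ONE Boolean; natively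
  instant, in the kernel use the split facts of `leaf_sound2`), ★★ `gramTree_sound : treeOK (leafOK2 μ) t c w = true → ∀ G with Gram data in the root box,
  μ/SC ≤ Σ_b W₄₅ ‖latPt G fccVec b‖`.

What remains above this for `HomFloor m` itself: the entry-coordinate root of `…HomCover.homFloor_of_entryCover` (entry→Gram interval squaring, hand-1 g20) and
reflected prune verdicts P1–P3 as alternative leaf verdicts.  0 sorry; standard axioms; no instances / notation.  `--supports stmt-AtomisticToContinuum-27623`.
-/

namespace Summit.AtomisticToContinuum.Crystallization.Theorems.FrustratedLawDichotomyStrainedPatchHomCertTree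

open scoped BigOperators RealInnerProductSpace
open Literature.Analysis.ValidatedNumerics.Numerics
open Summit.AtomisticToContinuum.Crystallization.Theorems.ChargedEnergyGapNegative (E3)
open Summit.AtomisticToContinuum.Crystallization.Theorems.FrustratedLawDichotomySchurCut (effPot w₄₅ ω₄)
open Summit.AtomisticToContinuum.Crystallization.Theorems.FrustratedLawDichotomyStrainedPatchHomSplit (latPt)
open Summit.AtomisticToContinuum.Crystallization.Theorems.FrustratedLawDichotomyStrainedPatchHomBisect (forall_box_of_forall_children)
open Summit.AtomisticToContinuum.Crystallization.Theorems.FrustratedLawDichotomyStrainedPatchHomLeafCheckW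
open Literature.Barriers.AtomisticToContinuum.FlatleyTheil2015 (fccVec)

/-! ## §1. Trees and the generic driver -/

/-- A bisection certificate: `leaf`, or `split k l r` = bisect coordinate `k`, `l` certifies the lower half, `r` the upper half. -/
inductive CertTree (κ : Type) where
  | leaf : CertTree κ
  | split : κ → CertTree κ → CertTree κ → CertTree κ

/-- Run the leaf verdict over the tree; boxes in scaled integers (centre `c`, half-widths `w`); a split needs `w k` even. -/
def treeOK {κ : Type} [DecidableEq κ] (verdict : (κ → ℤ) → (κ → ℤ) → Bool) : CertTree κ → (κ → ℤ) → (κ → ℤ) → Bool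
  | .leaf, c, w => verdict c w
  | .split k l r, c, w => decide (w k % 2 = 0) &&
      treeOK verdict l (Function.update c k (c k - w k / 2)) (Function.update w k (w k / 2)) &&
      treeOK verdict r (Function.update c k (c k + w k / 2)) (Function.update w k (w k / 2))

/-- Casting the integer children to the real children of `…HomBisect` (exact because `w k` is even). [formal bookkeeping] -/
theorem cast_update_child {κ : Type} [DecidableEq κ] (c w : κ → ℤ) (k : κ) (hw : w k % 2 = 0) {s : ℝ} (hs : 0 < s) (sgn : ℤ) (i : κ) :
    ((Function.update c k (c k + sgn * (w k / 2)) i : ℤ) : ℝ) / s =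
      Function.update (fun j => (c j : ℝ) / s) k ((c k : ℝ) / s + (sgn : ℝ) * (((w k : ℝ) / s) / 2)) i ∧
    ((Function.update w k (w k / 2) i : ℤ) : ℝ) / s = Function.update (fun j => (w j : ℝ) / s) k (((w k : ℝ) / s) / 2) i := by
  have h2 : (((w k / 2 : ℤ)) : ℝ) = (w k : ℝ) / 2 := by
    have : (w k / 2 : ℤ) * 2 = w k := Int.ediv_mul_cancel (Int.dvd_of_emod_eq_zero hw)
    have h' : (((w k / 2 : ℤ)) : ℝ) * 2 = (w k : ℝ) := by exact_mod_cast this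
    linarith
  by_cases hi : i = k
  · subst hi
    simp only [Function.update_self]
    push_cast
    rw [h2]
    constructor <;> field_simp
  · constructor <;> simp [Function.update_of_ne hi]

/-- ★ **SOUNDNESS OF THE TREE DRIVER** (structural induction): a sound leaf verdict for `P` makes `treeOK` a sound verdict for `P` on the root box. [folklore] -/
theorem treeOK_sound {κ : Type} [DecidableEq κ] {s : ℝ} (hs : 0 < s) {P : (κ → ℝ) → Prop} (verdict : (κ → ℤ) → (κ → ℤ) → Bool)
    (hver : ∀ c w : κ → ℤ, verdict c w = true → ∀ x : κ → ℝ, (∀ i, |x i - (c i : ℝ) / s| ≤ (w i : ℝ) / s) → P x) :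
    ∀ (t : CertTree κ) (c w : κ → ℤ), treeOK verdict t c w = true → ∀ x : κ → ℝ, (∀ i, |x i - (c i : ℝ) / s| ≤ (w i : ℝ) / s) → P x := by
  intro t
  induction t with
  | leaf => intro c w h x hx; exact hver c w h x hx
  | split k l r ihl ihr =>
    intro c w h x hx
    simp only [treeOK, Bool.and_eq_true, decide_eq_true_eq] at h
    obtain ⟨⟨hev, hl⟩, hr⟩ := h
    refine forall_box_of_forall_children (P := P) (fun j => (c j : ℝ) / s) (fun j => (w j : ℝ) / s) k ?_ ?_ x hx
    · intro y hy
      refine ihl _ _ hl y fun i => ?_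
      obtain ⟨e1, e2⟩ := cast_update_child c w k hev hs (-1) i
      have hy' := hy i
      rw [show (c k : ℝ) / s - (w k : ℝ) / s / 2 = (c k : ℝ) / s + ((-1 : ℤ) : ℝ) * (((w k : ℝ) / s) / 2) by push_cast; ring] at hy'
      rw [show Function.update c k (c k - w k / 2) = Function.update c k (c k + (-1) * (w k / 2)) by ring_nf, e1, e2]
      exact hy'
    · intro y hy
      refine ihr _ _ hr y fun i => ?_
      obtain ⟨e1, e2⟩ := cast_update_child c w k hev hs 1 i
      have hy' := hy i
      rw [show (c k : ℝ) / s + (w k : ℝ) / s / 2 = (c k : ℝ) / s + ((1 : ℤ) : ℝ) * (((w k : ℝ) / s) / 2) by push_cast; ring] at hy'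
      rw [show Function.update c k (c k + w k / 2) = Function.update c k (c k + 1 * (w k / 2)) by ring_nf, e1, e2]
      exact hy'

/-! ## §2. The fcc Gram instance -/

/-- The v2 Gram-leaf checker as ONE Boolean (natively instant; in the kernel prefer the split facts of `leaf_sound2`). -/
def leafOK2 (μ : ℤ) (c0 w : Fin 9 → ℤ) : Bool := termsOK2 c0 w && decide (μ ≤ sumV2 c0 - sumG2 c0 w - sumC2 c0 w)

/-- Soundness of `leafOK2` (from `leaf_sound2`). [folklore] -/
theorem leafOK2_sound {μ : ℤ} {c0 w : Fin 9 → ℤ} (h : leafOK2 μ c0 w = true) (G : E3 →L[ℝ] E3)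
    (hbox : ∀ k : Fin 9, |⟪G (fccVec ((@finProdFinEquiv 3 3).symm k).1), G (fccVec ((@finProdFinEquiv 3 3).symm k).2)⟫ - (c0 k : ℝ) / SC| ≤
      (w k : ℝ) / SC) :
    (μ : ℝ) / SC ≤ ∑ b ∈ (Fintype.piFinset fun _ : Fin 3 => Finset.Icc (-7 : ℤ) 7).filter (fun b => b ≠ 0), effPot w₄₅ ω₄ (3 / 400) ‖latPt G fccVec b‖ := by
  simp only [leafOK2, Bool.and_eq_true, decide_eq_true_eq] at h
  exact leaf_sound2 h.1 rfl rfl rfl h.2 G hbox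

/-- ★★ **SOUNDNESS OF A GRAM CERTIFICATE TREE**: `treeOK (leafOK2 μ) t c w = true` ⟹ for every deformation `G` whose nine frame Gram data lie in the ROOT box
`|⟪G fᵢ, G fⱼ⟫ − cₖ/SC| ≤ wₖ/SC`, the box sum of `W₄₅` is at least `μ/SC`. [folklore] -/
theorem gramTree_sound {μ : ℤ} {t : CertTree (Fin 9)} {c w : Fin 9 → ℤ} (h : treeOK (leafOK2 μ) t c w = true) (G : E3 →L[ℝ] E3)
    (hbox : ∀ k : Fin 9, |⟪G (fccVec ((@finProdFinEquiv 3 3).symm k).1), G (fccVec ((@finProdFinEquiv 3 3).symm k).2)⟫ - (c k : ℝ) / SC| ≤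
      (w k : ℝ) / SC) :
    (μ : ℝ) / SC ≤ ∑ b ∈ (Fintype.piFinset fun _ : Fin 3 => Finset.Icc (-7 : ℤ) 7).filter (fun b => b ≠ 0), effPot w₄₅ ω₄ (3 / 400) ‖latPt G fccVec b‖ :=
  treeOK_sound SC_pos (P := fun x : Fin 9 → ℝ => (∀ k : Fin 9, ⟪G (fccVec ((@finProdFinEquiv 3 3).symm k).1),
      G (fccVec ((@finProdFinEquiv 3 3).symm k).2)⟫ = x k) → (μ : ℝ) / SC ≤
      ∑ b ∈ (Fintype.piFinset fun _ : Fin 3 => Finset.Icc (-7 : ℤ) 7).filter (fun b => b ≠ 0), effPot w₄₅ ω₄ (3 / 400) ‖latPt G fccVec b‖)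
    (leafOK2 μ) (fun c0 w0 hv x hx hG => leafOK2_sound hv G fun k => by rw [hG k]; exact hx k) t c w h
    (fun k => ⟪G (fccVec ((@finProdFinEquiv 3 3).symm k).1), G (fccVec ((@finProdFinEquiv 3 3).symm k).2)⟫) hbox (fun _ => rfl)

/-! ## §3. Kernel smoke test of the driver (a tiny generic tree) -/

/-- A two-level tree over one coordinate with the verdict «half-width ≤ 2»: root half-width `8` fails at depth 1, passes at depth 2. -/
example : treeOK (κ := Fin 1) (fun _ w => decide (w 0 ≤ 2)) (.split 0 (.split 0 .leaf .leaf) (.split 0 .leaf .leaf)) (fun _ => 0) (fun _ => 8) = true ∧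
    treeOK (κ := Fin 1) (fun _ w => decide (w 0 ≤ 2)) (.split 0 .leaf .leaf) (fun _ => 0) (fun _ => 8) = false := by
  decide +kernel

end Summit.AtomisticToContinuum.Crystallization.Theorems.FrustratedLawDichotomyStrainedPatchHomCertTree
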